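import Mathlib.Data.Real.Basic
import Mathlib.Tactic.Ring
import Mathlib.Tactic.Linarith
import Mathlib.Tactic.Positivity
import Summits.CriticalPhenomena.PercolationContinuityZ3.Theorems.PercNearOneGluingNoHeavyLowerTailCubicThreePointBernsteinStep
import HarnessLib

/-!
# `NoHeavyLowerTail` (stmt-CriticalPhenomena-4575) — SHK3⁺ terminal-edge step: the Bernstein pieces as Richards–Sahi cubics (polarization identities) and the slice certificate

Support file (prover prim-ineq-harness-2 gen 3; `--supports stmt-CriticalPhenomena-4575`).  Pure algebra over a commutative ring / `ℝ`: no measure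
theory, no named facts, no sorries.  Companion of `PercNearOneGluingNoHeavyLowerTailCubicThreePointBernsteinStep` (`CubicThreePointStep.F`,
`threeB₁`, `threeB₂`, `F_segment_nonneg_of_bernstein`).

SETTING.  The terminal-edge step for SHK3⁺ (`F ≥ 0`) along the apex edge `e = {a,y}` lives on the 15-cell law `L` of the set partitions of the
four marked points `a,b,c,y` in `G∖e` (cell variables named `«a|b|c|y»`, …, `«abcy»` after the blocks); `x⁰ = (q,u₁,u₂,u₃,t)` is the induced law of
`(a,b,c)` and the transition masses of `bernstein_expansion` are the cells `α₁ = «a|by|c»`, `α₂ = «a|b|cy»`, `β₁ = «ab|cy»`, `β₂ = «ac|by»`,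
`β₃ = «a|bcy»`.  For events (sets of cells) `A,B,C` with masses `mA,…` the homogeneous Richards–Sahi form is
`E3h(σ; mA,mB,mC; mAB,mAC,mBC; mABC) = 2σ²·mABC + mA·mB·mC − σ(mA·mBC + mB·mAC + mC·mAB)` and the Harris form is `H(σ; mX,mY; mXY) = σ·mXY − mX·mY`
(both written INLINE below — no new definitions; `hybE(q,u₁,u₂,u₃,t,α₁,β₃)` denotes the inline hybrid cubic of `threeB₁_slice_eq`).
Events: `D_uv` = "u,v in different blocks" (in `G∖e`), `G_uv` = the same after merging the blocks of `a` and `y` (i.e. in `G/e`):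
`G_ab = D[ay|b]`, `G_ac = D[ay|c]`, `G_bc = D_bc ∖ {ab|cy, ac|by}`.

RESULTS (all `ring` identities or elementary sign arguments).
* `threeB₁_polarization` (P1′):  `threeB₁ = E3(D_bc,D_ac,G_ab) + E3(D_bc,G_ac,D_ab) + F(x⁰) + (β₁+β₂)·H(D_ab,D_ac) − σ·β₃·m(D_bc)`.
* `threeB₂_polarization` (P2′):  `threeB₂ = E3(D_bc,G_ac,G_ab) + E3(D_bc,D_ac,G_ab) + E3(D_bc,G_ac,D_ab) + (β₁+β₂)·[H(D_ac,G_ab)+H(G_ac,D_ab)] − σ·β₃·m(G_bc)`.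
  So each Bernstein piece is a sum of HYBRID Richards–Sahi cubics (one slot evaluated in the contracted graph) plus Harris terms minus ONE
  product (`σ·β₃·m(D_bc)`, resp. `σ·β₃·m(G_bc)`).
* On the slice `β₁ = β₂ = 0` everything is a polynomial in the transition variables; the hybrid row is `hybE` (`hybE_eq_cells`),
  `threeB₁_slice_eq`, `threeB₂_slice_eq` restate (P1′),(P2′) there, and `slice_certificate₁` is the (unique, degree-2) syzygy
      `(2A)(2B)·threeB₁ = ((2A)(2B) − (2A')(2B'))·hybE + (2A)((2B)+(2B'))·F(x⁰) + (2A')(2B)·F(x¹)`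
  with masses `2A = 2t+α₁+u₁+u₃+β₃`, `2B = q+u₁+2u₂+u₃+2t`, `2A' = 2t+u₁+u₃`, `2B' = 2B+α₂+β₃`, whose multiplier difference is
  `¼[(α₁−α₂)(…) + (α₁+α₂+2β₃)(…)]` (`slice_multiplier_sub`).  Hence `threeB₁_nonneg_slice_of_le`: on the slice, in the region `α₂ ≤ α₁`,
  `threeB₁ ≥ 0` follows from ONE hybrid row `hybE ≥ 0` and the induction hypotheses `F(x⁰), F(x¹) ≥ 0`; the region `α₁ ≤ α₂` is the
  `b ↔ c` mirror (`threeB₁_nonneg_slice_of_ge`), and `bernstein_nonneg_slice` gives both pieces from both hybrid rows.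
These identities were found and verified by exact computer algebra (harness-2 reports BERN4-POLARIZATION-harness2.md; (P1′),(P2′) independently
re-derived by the prim-sahi referee, REFEREE.md R9); here `ring` re-proves them.  Off the slice no polynomial certificate of degree ≤ 5 over
{IH, hybrid rows, Harris, ccbk} exists (LP evidence in the report); the census-validated 4-point inequalities
`(L1) E3(D_bc,D_ac,G_ab)+E3(D_bc,G_ac,D_ab) ≥ σβ₃m(D_bc)` and `(L2)` (0 violations on 3.1·10⁶ exact instances, ttrl2 bern4/README) are the open targets
that would close the step for all graphs; they are not formalised here.  [cite: Gladkov2024StrongFKG, Cor. 4.2 (quadratic part)]; [cite: GladkovZimin2024HK, §4 (coordinate induction)]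
-/

namespace Summit.CriticalPhenomena.PercolationContinuityZ3.Theorems

namespace CubicThreePointStep

variable {R : Type*} [CommRing R]

/-- **(P1′) Polarization identity for the first Bernstein piece of SHK3⁺ along the apex edge `{a,y}`**, in the 15 cells of the
4-point law of `(a,b,c,y)` in `G∖e`:
`threeB₁ = E3(D_bc,D_ac,G_ab) + E3(D_bc,G_ac,D_ab) + F(x⁰) + (β₁+β₂)·H(D_ab,D_ac) − σ·β₃·m(D_bc)`. [folklore] -/
theorem threeB₁_polarization («a|b|c|y» «a|b|cy» «a|by|c» «a|bc|y» «ay|b|c» «ac|b|y» «ab|c|y» «a|bcy» «ay|bc» «ac|by» «acy|b» «ab|cy» «aby|c» «abc|y» «abcy» : R) :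
    threeB₁ («a|b|c|y» + «a|b|cy» + «a|by|c» + «ay|b|c») («ab|c|y» + «ab|cy» + «aby|c») («ac|b|y» + «ac|by» + «acy|b») («a|bc|y» + «a|bcy» + «ay|bc») («abc|y» + «abcy») «a|by|c» «a|b|cy» «ab|cy» «ac|by» «a|bcy»
      = (2 * («a|b|c|y» + «a|b|cy» + «a|by|c» + «a|bc|y» + «ay|b|c» + «ac|b|y» + «ab|c|y» + «a|bcy» + «ay|bc» + «ac|by» + «acy|b» + «ab|cy» + «aby|c» + «abc|y» + «abcy») ^ 2 * («a|b|c|y» + «a|b|cy» + «ay|b|c») + («a|b|c|y» + «a|b|cy» + «a|by|c» + «ay|b|c» + «ac|b|y» + «ab|c|y» + «ac|by» + «acy|b» + «ab|cy» + «aby|c») * («a|b|c|y» + «a|b|cy» + «a|by|c» + «a|bc|y» + «ay|b|c» + «ab|c|y» + «a|bcy» + «ay|bc» + «ab|cy» + «aby|c») * («a|b|c|y» + «a|b|cy» + «a|bc|y» + «ay|b|c» + «ac|b|y» + «ay|bc» + «acy|b») - («a|b|c|y» + «a|b|cy» + «a|by|c» + «a|bc|y» + «ay|b|c» + «ac|b|y»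 + «ab|c|y» + «a|bcy» + «ay|bc» + «ac|by» + «acy|b» + «ab|cy» + «aby|c» + «abc|y» + «abcy») * ((«a|b|c|y» + «a|b|cy» + «a|by|c» + «ay|b|c» + «ac|b|y» + «ab|c|y» + «ac|by» + «acy|b» + «ab|cy» + «aby|c») * («a|b|c|y» + «a|b|cy» + «a|bc|y» + «ay|b|c» + «ay|bc») + («a|b|c|y» + «a|b|cy» + «a|by|c» + «a|bc|y» + «ay|b|c» + «ab|c|y» + «a|bcy» + «ay|bc» + «ab|cy» + «aby|c») * («a|b|c|y» + «a|b|cy» + «ay|b|c» + «ac|b|y» + «acy|b») + («a|b|c|y» + «a|b|cy» + «a|bc|y» + «ay|b|c» + «ac|b|y» + «ay|bc» + «acy|b») * («a|b|c|y» + «a|b|cy» + «a|by|c» + «ay|b|c» + «ab|c|y» + «ab|cy» + «aby|c»))) + (2 * («a|b|c|y» + «a|b|cy» + «a|by|c» + «a|bc|y» + «ay|b|c» + «ac|b|y» + «ab|c|y» + «a|bcy» + «ay|bc» + «ac|by» + «acy|b» + «ab|cy» + «aby|c» + «abc|y» + «abcy») ^ 2 * («a|b|c|y» + «a|by|c» +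 «ay|b|c») + («a|b|c|y» + «a|b|cy» + «a|by|c» + «ay|b|c» + «ac|b|y» + «ab|c|y» + «ac|by» + «acy|b» + «ab|cy» + «aby|c») * («a|b|c|y» + «a|by|c» + «a|bc|y» + «ay|b|c» + «ab|c|y» + «ay|bc» + «aby|c») * («a|b|c|y» + «a|b|cy» + «a|by|c» + «a|bc|y» + «ay|b|c» + «ac|b|y» + «a|bcy» + «ay|bc» + «ac|by» + «acy|b») - («a|b|c|y» + «a|b|cy» + «a|by|c» + «a|bc|y» + «ay|b|c» + «ac|b|y» + «ab|c|y» + «a|bcy» + «ay|bc» + «ac|by» + «acy|b» + «ab|cy» + «aby|c» + «abc|y» + «abcy») * ((«a|b|c|y» + «a|b|cy» + «a|by|c» + «ay|b|c» + «ac|b|y» + «ab|c|y» + «ac|by» + «acy|b» + «ab|cy» + «aby|c») * («a|b|c|y» + «a|by|c» + «a|bc|y» + «ay|b|c» + «ay|bc») + («a|b|c|y» + «a|by|c» + «a|bc|y» + «ay|b|c» + «ab|c|y» + «ay|bc» + «aby|c») * («a|b|c|y» + «a|b|cy» + «a|by|c» + «ay|b|c» + «ac|b|y» + «ac|by» + «acy|b»)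 + («a|b|c|y» + «a|b|cy» + «a|by|c» + «a|bc|y» + «ay|b|c» + «ac|b|y» + «a|bcy» + «ay|bc» + «ac|by» + «acy|b») * («a|b|c|y» + «a|by|c» + «ay|b|c» + «ab|c|y» + «aby|c»))) + F («a|b|c|y» + «a|b|cy» + «a|by|c» + «ay|b|c») («ab|c|y» + «ab|cy» + «aby|c») («ac|b|y» + «ac|by» + «acy|b») («a|bc|y» + «a|bcy» + «ay|bc») («abc|y» + «abcy») + («ab|cy» + «ac|by») * ((«a|b|c|y» + «a|b|cy» + «a|by|c» + «a|bc|y» + «ay|b|c» + «ac|b|y» + «ab|c|y» + «a|bcy» + «ay|bc» + «ac|by» + «acy|b» + «ab|cy» + «aby|c» + «abc|y» + «abcy») * («a|b|c|y» + «a|b|cy» + «a|by|c» + «a|bc|y» + «ay|b|c» + «a|bcy» + «ay|bc») - («a|b|c|y» + «a|b|cy» + «a|by|c» + «a|bc|y» + «ay|b|c» + «ac|b|y» + «a|bcy» + «ay|bc» + «ac|by» + «acy|b») * («a|b|c|y» + «a|b|cy» + «a|by|c» + «a|bc|y» + «ay|b|c» + «ab|c|y» + «a|bcy» + «ay|bc»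 + «ab|cy» + «aby|c»)) - («a|b|c|y» + «a|b|cy» + «a|by|c» + «a|bc|y» + «ay|b|c» + «ac|b|y» + «ab|c|y» + «a|bcy» + «ay|bc» + «ac|by» + «acy|b» + «ab|cy» + «aby|c» + «abc|y» + «abcy») * «a|bcy» * («a|b|c|y» + «a|b|cy» + «a|by|c» + «ay|b|c» + «ac|b|y» + «ab|c|y» + «ac|by» + «acy|b» + «ab|cy» + «aby|c») := by
  simp only [threeB₁, F]
  ring

/-- **(P2′) Polarization identity for the second Bernstein piece**:
`threeB₂ = E3(D_bc,G_ac,G_ab) + E3(D_bc,D_ac,G_ab) + E3(D_bc,G_ac,D_ab) + (β₁+β₂)·(H(D_ac,G_ab) + H(G_ac,D_ab)) − σ·β₃·m(G_bc)`. [folklore] -/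
theorem threeB₂_polarization («a|b|c|y» «a|b|cy» «a|by|c» «a|bc|y» «ay|b|c» «ac|b|y» «ab|c|y» «a|bcy» «ay|bc» «ac|by» «acy|b» «ab|cy» «aby|c» «abc|y» «abcy» : R) :
    threeB₂ («a|b|c|y» + «a|b|cy» + «a|by|c» + «ay|b|c») («ab|c|y» + «ab|cy» + «aby|c») («ac|b|y» + «ac|by» + «acy|b») («a|bc|y» + «a|bcy» + «ay|bc») («abc|y» + «abcy») «a|by|c» «a|b|cy» «ab|cy» «ac|by» «a|bcy»
      = (2 * («a|b|c|y» + «a|b|cy» + «a|by|c» + «a|bc|y» + «ay|b|c» + «ac|b|y» + «ab|c|y» + «a|bcy» + «ay|bc» + «ac|by» + «acy|b» + «ab|cy» + «aby|c» + «abc|y» + «abcy») ^ 2 * («a|b|c|y» + «ay|b|c») + («a|b|c|y» + «a|b|cy» + «a|by|c» + «ay|b|c» + «ac|b|y» + «ab|c|y» + «ac|by» + «acy|b» + «ab|cy» + «aby|c») * («a|b|c|y» + «a|by|c» + «a|bc|y» + «ay|b|c» + «ab|c|y» + «ay|bc» + «aby|c») * («a|b|c|y» + «a|b|cy» + «a|bc|y»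 + «ay|b|c» + «ac|b|y» + «ay|bc» + «acy|b») - («a|b|c|y» + «a|b|cy» + «a|by|c» + «a|bc|y» + «ay|b|c» + «ac|b|y» + «ab|c|y» + «a|bcy» + «ay|bc» + «ac|by» + «acy|b» + «ab|cy» + «aby|c» + «abc|y» + «abcy») * ((«a|b|c|y» + «a|b|cy» + «a|by|c» + «ay|b|c» + «ac|b|y» + «ab|c|y» + «ac|by» + «acy|b» + «ab|cy» + «aby|c») * («a|b|c|y» + «a|bc|y» + «ay|b|c» + «ay|bc») + («a|b|c|y» + «a|by|c» + «a|bc|y» + «ay|b|c» + «ab|c|y» + «ay|bc» + «aby|c») * («a|b|c|y» + «a|b|cy» + «ay|b|c» + «ac|b|y» + «acy|b») + («a|b|c|y» + «a|b|cy» + «a|bc|y» + «ay|b|c» + «ac|b|y» + «ay|bc» + «acy|b») * («a|b|c|y» + «a|by|c» + «ay|b|c» + «ab|c|y» + «aby|c»))) + (2 * («a|b|c|y» + «a|b|cy» + «a|by|c» + «a|bc|y» + «ay|b|c» + «ac|b|y» + «ab|c|y» + «a|bcy» + «ay|bc» + «ac|by» + «acy|b» + «ab|cy» + «aby|c» + «abc|y»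 + «abcy») ^ 2 * («a|b|c|y» + «a|b|cy» + «ay|b|c») + («a|b|c|y» + «a|b|cy» + «a|by|c» + «ay|b|c» + «ac|b|y» + «ab|c|y» + «ac|by» + «acy|b» + «ab|cy» + «aby|c») * («a|b|c|y» + «a|b|cy» + «a|by|c» + «a|bc|y» + «ay|b|c» + «ab|c|y» + «a|bcy» + «ay|bc» + «ab|cy» + «aby|c») * («a|b|c|y» + «a|b|cy» + «a|bc|y» + «ay|b|c» + «ac|b|y» + «ay|bc» + «acy|b») - («a|b|c|y» + «a|b|cy» + «a|by|c» + «a|bc|y» + «ay|b|c» + «ac|b|y» + «ab|c|y» + «a|bcy» + «ay|bc» + «ac|by» + «acy|b» + «ab|cy» + «aby|c» + «abc|y» + «abcy») * ((«a|b|c|y» + «a|b|cy» + «a|by|c» + «ay|b|c» + «ac|b|y» + «ab|c|y» + «ac|by» + «acy|b» + «ab|cy» + «aby|c») * («a|b|c|y» + «a|b|cy» + «a|bc|y» + «ay|b|c» + «ay|bc») + («a|b|c|y» + «a|b|cy» + «a|by|c» + «a|bc|y» + «ay|b|c» + «ab|c|y» + «a|bcy» + «ay|bc» + «ab|cy» +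 «aby|c») * («a|b|c|y» + «a|b|cy» + «ay|b|c» + «ac|b|y» + «acy|b») + («a|b|c|y» + «a|b|cy» + «a|bc|y» + «ay|b|c» + «ac|b|y» + «ay|bc» + «acy|b») * («a|b|c|y» + «a|b|cy» + «a|by|c» + «ay|b|c» + «ab|c|y» + «ab|cy» + «aby|c»))) + (2 * («a|b|c|y» + «a|b|cy» + «a|by|c» + «a|bc|y» + «ay|b|c» + «ac|b|y» + «ab|c|y» + «a|bcy» + «ay|bc» + «ac|by» + «acy|b» + «ab|cy» + «aby|c» + «abc|y» + «abcy») ^ 2 * («a|b|c|y» + «a|by|c» + «ay|b|c») + («a|b|c|y» + «a|b|cy» + «a|by|c» + «ay|b|c» + «ac|b|y» + «ab|c|y» + «ac|by» + «acy|b» + «ab|cy» + «aby|c») * («a|b|c|y» + «a|by|c» + «a|bc|y» + «ay|b|c» + «ab|c|y» + «ay|bc» + «aby|c») * («a|b|c|y» + «a|b|cy» + «a|by|c» + «a|bc|y» + «ay|b|c» + «ac|b|y» + «a|bcy» + «ay|bc» + «ac|by» + «acy|b») - («a|b|c|y» + «a|b|cy» + «a|by|c» + «a|bc|y» + «ay|b|c»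 + «ac|b|y» + «ab|c|y» + «a|bcy» + «ay|bc» + «ac|by» + «acy|b» + «ab|cy» + «aby|c» + «abc|y» + «abcy») * ((«a|b|c|y» + «a|b|cy» + «a|by|c» + «ay|b|c» + «ac|b|y» + «ab|c|y» + «ac|by» + «acy|b» + «ab|cy» + «aby|c») * («a|b|c|y» + «a|by|c» + «a|bc|y» + «ay|b|c» + «ay|bc») + («a|b|c|y» + «a|by|c» + «a|bc|y» + «ay|b|c» + «ab|c|y» + «ay|bc» + «aby|c») * («a|b|c|y» + «a|b|cy» + «a|by|c» + «ay|b|c» + «ac|b|y» + «ac|by» + «acy|b») + («a|b|c|y» + «a|b|cy» + «a|by|c» + «a|bc|y» + «ay|b|c» + «ac|b|y» + «a|bcy» + «ay|bc» + «ac|by» + «acy|b») * («a|b|c|y» + «a|by|c» + «ay|b|c» + «ab|c|y» + «aby|c»))) + («ab|cy» + «ac|by») * (((«a|b|c|y» + «a|b|cy» + «a|by|c» + «a|bc|y» + «ay|b|c» + «ac|b|y» + «ab|c|y» + «a|bcy» + «ay|bc» + «ac|by» + «acy|b» + «ab|cy» + «aby|c» + «abc|y» + «abcy») * («a|b|c|y»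 + «a|b|cy» + «a|bc|y» + «ay|b|c» + «ay|bc») - («a|b|c|y» + «a|b|cy» + «a|by|c» + «a|bc|y» + «ay|b|c» + «ab|c|y» + «a|bcy» + «ay|bc» + «ab|cy» + «aby|c») * («a|b|c|y» + «a|b|cy» + «a|bc|y» + «ay|b|c» + «ac|b|y» + «ay|bc» + «acy|b»)) + ((«a|b|c|y» + «a|b|cy» + «a|by|c» + «a|bc|y» + «ay|b|c» + «ac|b|y» + «ab|c|y» + «a|bcy» + «ay|bc» + «ac|by» + «acy|b» + «ab|cy» + «aby|c» + «abc|y» + «abcy») * («a|b|c|y» + «a|by|c» + «a|bc|y» + «ay|b|c» + «ay|bc») - («a|b|c|y» + «a|by|c» + «a|bc|y» + «ay|b|c» + «ab|c|y» + «ay|bc» + «aby|c») * («a|b|c|y» + «a|b|cy» + «a|by|c» + «a|bc|y» + «ay|b|c» + «ac|b|y» + «a|bcy» + «ay|bc» + «ac|by» + «acy|b»))) - («a|b|c|y» + «a|b|cy» + «a|by|c» + «a|bc|y» + «ay|b|c» + «ac|b|y» + «ab|c|y» + «a|bcy» + «ay|bc» + «ac|by» + «acy|b» + «ab|cy» + «aby|c»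 + «abc|y» + «abcy») * «a|bcy» * («a|b|c|y» + «a|b|cy» + «a|by|c» + «ay|b|c» + «ac|b|y» + «ab|c|y» + «acy|b» + «aby|c») := by
  simp only [threeB₂]
  ring


/-! ### The slice `β₁ = β₂ = 0`: an explicit two-case polynomial certificate

On the slice `β₁ = β₂ = 0` every quantity of the step depends only on the transition-model variables
`(q,u₁,u₂,u₃,t,α₁,α₂,β₃)`; the hybrid Richards–Sahi row `E3(D_bc, D_ac, G_ab)` (events `b≁c`, `a≁c`, `b≁{a,y}` of the
4-point law) becomes `hybE q u₁ u₂ u₃ t α₁ β₃`, and its `b ↔ c` mirror `E3(D_bc, G_ac, D_ab)` is `hybE q u₂ u₁ u₃ t α₂ β₃`. -/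

section Slice

set_option maxRecDepth 10000 in
set_option maxHeartbeats 1600000 in
/-- On the slice the cell-level hybrid row `E3(D_bc,D_ac,G_ab)` IS `hybE` (cell embedding of `bernstein_expansion`:
`q = «a|b|c|y»+«a|b|cy»+«a|by|c»+«ay|b|c»`, …, `β₃ = «a|bcy»`, with `«ab|cy» = «ac|by» = 0`). [folklore] -/
theorem hybE_eq_cells («a|b|c|y» «a|b|cy» «a|by|c» «a|bc|y» «ay|b|c» «ac|b|y» «ab|c|y» «a|bcy» «ay|bc» «ac|by» «acy|b» «ab|cy» «aby|c» «abc|y» «abcy» : R) (z11 : «ab|cy» = 0) (z9 : «ac|by» = 0) :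
    (2 * («a|b|c|y» + «a|b|cy» + «a|by|c» + «a|bc|y» + «ay|b|c» + «ac|b|y» + «ab|c|y» + «a|bcy» + «ay|bc» + «ac|by» + «acy|b» + «ab|cy» + «aby|c» + «abc|y» + «abcy») ^ 2 * («a|b|c|y» + «a|b|cy» + «ay|b|c») + («a|b|c|y» + «a|b|cy» + «a|by|c» + «ay|b|c» + «ac|b|y» + «ab|c|y» + «ac|by» + «acy|b» + «ab|cy» + «aby|c») * («a|b|c|y» + «a|b|cy» + «a|by|c» + «a|bc|y» + «ay|b|c» + «ab|c|y» + «a|bcy» + «ay|bc» + «ab|cy» + «aby|c») * («a|b|c|y» + «a|b|cy» + «a|bc|y» + «ay|b|c» + «ac|b|y» + «ay|bc» + «acy|b») - («a|b|c|y» + «a|b|cy» + «a|by|c» + «a|bc|y» + «ay|b|c» + «ac|b|y» + «ab|c|y» + «a|bcy» + «ay|bc» + «ac|by» + «acy|b» + «ab|cy» + «aby|c» + «abc|y» + «abcy») * ((«a|b|c|y» + «a|b|cy» + «a|by|c» + «ay|b|c» + «ac|b|y» + «ab|c|y» + «ac|by» + «acy|b» + «ab|cy» + «aby|c») * («a|b|c|y»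 + «a|b|cy» + «a|bc|y» + «ay|b|c» + «ay|bc») + («a|b|c|y» + «a|b|cy» + «a|by|c» + «a|bc|y» + «ay|b|c» + «ab|c|y» + «a|bcy» + «ay|bc» + «ab|cy» + «aby|c») * («a|b|c|y» + «a|b|cy» + «ay|b|c» + «ac|b|y» + «acy|b») + («a|b|c|y» + «a|b|cy» + «a|bc|y» + «ay|b|c» + «ac|b|y» + «ay|bc» + «acy|b») * («a|b|c|y» + «a|b|cy» + «a|by|c» + «ay|b|c» + «ab|c|y» + «ab|cy» + «aby|c»)))
      = (2 * ((«a|b|c|y» + «a|b|cy» + «a|by|c» + «ay|b|c») + («ab|c|y» + «ab|cy» + «aby|c») + («ac|b|y» + «ac|by» + «acy|b») + («a|bc|y» + «a|bcy» + «ay|bc») + («abc|y» + «abcy»)) ^ 2 * ((«a|b|c|y» + «a|b|cy» + «a|by|c» + «ay|b|c») - «a|by|c») + ((«a|b|c|y» + «a|b|cy» + «a|by|c» + «ay|b|c») + («ab|c|y» + «ab|cy» + «aby|c») + («ac|b|y» + «ac|by» + «acy|b») + («a|bc|y» + «a|bcy» + «ay|bc») + («abc|y» + «abcy») - («a|bc|y»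 + «a|bcy» + «ay|bc») - («abc|y» + «abcy»)) * ((«a|b|c|y» + «a|b|cy» + «a|by|c» + «ay|b|c») + («ab|c|y» + «ab|cy» + «aby|c») + («ac|b|y» + «ac|by» + «acy|b») + («a|bc|y» + «a|bcy» + «ay|bc») + («abc|y» + «abcy») - («ac|b|y» + «ac|by» + «acy|b») - («abc|y» + «abcy»)) * ((«a|b|c|y» + «a|b|cy» + «a|by|c» + «ay|b|c») + («ab|c|y» + «ab|cy» + «aby|c») + («ac|b|y» + «ac|by» + «acy|b») + («a|bc|y» + «a|bcy» + «ay|bc») + («abc|y» + «abcy») - («abc|y» + «abcy») - («ab|c|y» + «ab|cy» + «aby|c») - «a|by|c» - «a|bcy») - ((«a|b|c|y» + «a|b|cy» + «a|by|c» + «ay|b|c») + («ab|c|y» + «ab|cy» + «aby|c») + («ac|b|y» + «ac|by» + «acy|b») + («a|bc|y» + «a|bcy» + «ay|bc») + («abc|y» + «abcy»)) * (((«a|b|c|y» + «a|b|cy» + «a|by|c» + «ay|b|c») + («ab|c|y» + «ab|cy» + «aby|c») + («ac|b|y» + «ac|by» + «acy|b») + («a|bc|y» + «a|bcy» + «ay|bc»)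 + («abc|y» + «abcy») - («a|bc|y» + «a|bcy» + «ay|bc») - («abc|y» + «abcy»)) * ((«a|b|c|y» + «a|b|cy» + «a|by|c» + «ay|b|c») - «a|by|c» + («a|bc|y» + «a|bcy» + «ay|bc») - «a|bcy») + ((«a|b|c|y» + «a|b|cy» + «a|by|c» + «ay|b|c») + («ab|c|y» + «ab|cy» + «aby|c») + («ac|b|y» + «ac|by» + «acy|b») + («a|bc|y» + «a|bcy» + «ay|bc») + («abc|y» + «abcy») - («ac|b|y» + «ac|by» + «acy|b») - («abc|y» + «abcy»)) * ((«a|b|c|y» + «a|b|cy» + «a|by|c» + «ay|b|c») - «a|by|c» + («ac|b|y» + «ac|by» + «acy|b»)) + ((«a|b|c|y» + «a|b|cy» + «a|by|c» + «ay|b|c») + («ab|c|y» + «ab|cy» + «aby|c») + («ac|b|y» + «ac|by» + «acy|b») + («a|bc|y» + «a|bcy» + «ay|bc») + («abc|y» + «abcy») - («abc|y» + «abcy») - («ab|c|y» + «ab|cy» + «aby|c») - «a|by|c» - «a|bcy») * ((«a|b|c|y» + «a|b|cy» + «a|by|c» + «ay|b|c») + («ab|c|y» + «ab|cy» + «aby|c»)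 + («ac|b|y» + «ac|by» + «acy|b») + («a|bc|y» + «a|bcy» + «ay|bc») + («abc|y» + «abcy») - («ac|b|y» + «ac|by» + «acy|b») - («a|bc|y» + «a|bcy» + «ay|bc») - («abc|y» + «abcy»)))) := by
  subst z11 z9
  ring

/-- (P1′) restricted to the slice, in transition variables:
`threeB₁ = hybE(q,u₁,u₂,u₃,t,α₁,β₃) + hybE(q,u₂,u₁,u₃,t,α₂,β₃) + F(x⁰) − σ·β₃·(q+u₁+u₂)`, where `hybE` is the hybrid row
`E3(b≁c, a≁c, b≁{a,y})` written out: `E3h(σ; σ−u₃−t, σ−u₂−t, σ−t−u₁−α₁−β₃; σ−u₂−u₃−t, q−α₁+u₂, q−α₁+u₃−β₃; q−α₁)`. [folklore] -/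
theorem threeB₁_slice_eq (q u₁ u₂ u₃ t α₁ α₂ β₃ : R) :
    threeB₁ q u₁ u₂ u₃ t α₁ α₂ 0 0 β₃
      = (2 * (q + u₁ + u₂ + u₃ + t) ^ 2 * (q - α₁) + (q + u₁ + u₂ + u₃ + t - u₃ - t) * (q + u₁ + u₂ + u₃ + t - u₂ - t) * (q + u₁ + u₂ + u₃ + t - t - u₁ - α₁ - β₃) - (q + u₁ + u₂ + u₃ + t) * ((q + u₁ + u₂ + u₃ + t - u₃ - t) * (q - α₁ + u₃ - β₃) + (q + u₁ + u₂ + u₃ + t - u₂ - t) * (q - α₁ + u₂) + (q + u₁ + u₂ + u₃ + t - t - u₁ - α₁ - β₃) * (q + u₁ + u₂ + u₃ + t - u₂ - u₃ - t))) + (2 * (q + u₂ + u₁ + u₃ + t) ^ 2 * (q - α₂) + (q + u₂ + u₁ + u₃ + t - u₃ - t) * (q + u₂ + u₁ + u₃ + t - u₁ - t) * (q + u₂ + u₁ + u₃ + t - t - u₂ - α₂ - β₃) - (q + u₂ + u₁ + u₃ + t) * ((q + u₂ + u₁ + u₃ + t - u₃ - t) * (q - α₂ + u₃ - β₃) + (q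 + u₂ + u₁ + u₃ + t - u₁ - t) * (q - α₂ + u₁) + (q + u₂ + u₁ + u₃ + t - t - u₂ - α₂ - β₃) * (q + u₂ + u₁ + u₃ + t - u₁ - u₃ - t))) + F q u₁ u₂ u₃ t
        - (q + u₁ + u₂ + u₃ + t) * β₃ * (q + u₁ + u₂) := by
  simp only [threeB₁, F]
  ring

/-- `threeB₂ = threeB₁ − F(x⁰) + F(x¹)` on the slice. [folklore] -/
theorem threeB₂_slice_eq (q u₁ u₂ u₃ t α₁ α₂ β₃ : R) :
    threeB₂ q u₁ u₂ u₃ t α₁ α₂ 0 0 β₃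
      = threeB₁ q u₁ u₂ u₃ t α₁ α₂ 0 0 β₃ - F q u₁ u₂ u₃ t
        + F (q - α₁ - α₂) (u₁ + α₁) (u₂ + α₂) (u₃ - β₃) (t + β₃) := by
  simp only [threeB₁, threeB₂, F]
  ring

set_option maxRecDepth 10000 in
/-- **The slice syzygy / certificate (region `α₂ ≤ α₁`).**  With the masses `2A = 2t+α₁+u₁+u₃+β₃`, `2B = q+u₁+2u₂+u₃+2t`,
`2A' = 2t+u₁+u₃`, `2B' = 2B+α₂+β₃`:
`(2A)(2B)·threeB₁ = ((2A)(2B) − (2A')(2B'))·hybE + (2A)((2B)+(2B'))·F(x⁰) + (2A')(2B)·F(x¹)` (`hybE` = the hybrid row of `threeB₁_slice_eq`).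
This is (16×) the unique degree-2 syzygy among the four cubics on the slice; note that the mirror row does not enter. [folklore] -/
theorem slice_certificate₁ (q u₁ u₂ u₃ t α₁ α₂ β₃ : R) :
    ((2 * t + α₁ + u₁ + u₃ + β₃) * (q + u₁ + 2 * u₂ + u₃ + 2 * t)) * threeB₁ q u₁ u₂ u₃ t α₁ α₂ 0 0 β₃
      = ((2 * t + α₁ + u₁ + u₃ + β₃) * (q + u₁ + 2 * u₂ + u₃ + 2 * t)
            - (2 * t + u₁ + u₃) * (q + u₁ + 2 * u₂ + u₃ + 2 * t + α₂ + β₃)) * (2 * (q + u₁ + u₂ + u₃ + t) ^ 2 * (q - α₁) + (q + u₁ + u₂ + u₃ + t - u₃ - t) * (q + u₁ + u₂ + u₃ + t - u₂ - t) * (q + u₁ + u₂ + u₃ + t - t - u₁ - α₁ - β₃) - (q + u₁ + u₂ + u₃ + t) * ((q + u₁ + u₂ + u₃ + t - u₃ - t) * (q - α₁ + u₃ - β₃) + (q + u₁ + u₂ + u₃ + t - u₂ - t) * (q - α₁ + u₂) + (q + u₁ + u₂ + u₃ + t - t - u₁ - α₁ - β₃) * (q + u₁ + u₂ + u₃ +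 t - u₂ - u₃ - t)))
        + (2 * t + α₁ + u₁ + u₃ + β₃) * ((q + u₁ + 2 * u₂ + u₃ + 2 * t) + (q + u₁ + 2 * u₂ + u₃ + 2 * t + α₂ + β₃))
            * F q u₁ u₂ u₃ t
        + ((2 * t + u₁ + u₃) * (q + u₁ + 2 * u₂ + u₃ + 2 * t))
            * F (q - α₁ - α₂) (u₁ + α₁) (u₂ + α₂) (u₃ - β₃) (t + β₃) := by
  simp only [threeB₁, F]
  ring

/-- The multiplier difference of `slice_certificate₁` is manifestly nonnegative in the region `α₂ ≤ α₁`: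
`4·((2A)(2B) − (2A')(2B')) = (α₁−α₂)·(2q+α₁+α₂+4u₁+4u₂+4u₃+2β₃+8t) + (α₁+α₂+2β₃)·(2q−α₁+α₂+4u₂)`. [folklore] -/
theorem slice_multiplier_sub (q u₁ u₂ u₃ t α₁ α₂ β₃ : R) :
    4 * ((2 * t + α₁ + u₁ + u₃ + β₃) * (q + u₁ + 2 * u₂ + u₃ + 2 * t)
          - (2 * t + u₁ + u₃) * (q + u₁ + 2 * u₂ + u₃ + 2 * t + α₂ + β₃))
      = (α₁ - α₂) * (2 * q + α₁ + α₂ + 4 * u₁ + 4 * u₂ + 4 * u₃ + 2 * β₃ + 8 * t)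
        + (α₁ + α₂ + 2 * β₃) * (2 * q - α₁ + α₂ + 4 * u₂) := by
  ring

/-- `b ↔ c` symmetry of the first Bernstein piece on the slice. [folklore] -/
theorem threeB₁_slice_swap (q u₁ u₂ u₃ t α₁ α₂ β₃ : R) :
    threeB₁ q u₂ u₁ u₃ t α₂ α₁ 0 0 β₃ = threeB₁ q u₁ u₂ u₃ t α₁ α₂ 0 0 β₃ := by
  simp only [threeB₁]
  ring

/-- `b ↔ c` symmetry of `F`. [folklore] -/
theorem F_swap (q u₁ u₂ u₃ t : R) : F q u₂ u₁ u₃ t = F q u₁ u₂ u₃ t := by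
  simp only [F]
  ring

set_option maxHeartbeats 800000 in
/-- **First Bernstein piece ≥ 0 on the slice, region `α₂ ≤ α₁`**, from ONE hybrid Richards–Sahi row `hybE ≥ 0` (i.e.
`E3(b≁c, a≁c, b≁{a,y}) ≥ 0` for the 4-point law of `G∖e`) and the induction hypotheses `F(x⁰) ≥ 0`, `F(x¹) ≥ 0`. [folklore] -/
theorem threeB₁_nonneg_slice_of_le {q u₁ u₂ u₃ t α₁ α₂ β₃ : ℝ}
    (hu₁ : 0 ≤ u₁) (hu₂ : 0 ≤ u₂) (ht : 0 ≤ t) (hα₁ : 0 ≤ α₁) (hα₂ : 0 ≤ α₂) (hβ₃ : 0 ≤ β₃)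
    (hq : α₁ + α₂ ≤ q) (hu₃ : β₃ ≤ u₃) (hreg : α₂ ≤ α₁)
    (hE : 0 ≤ (2 * (q + u₁ + u₂ + u₃ + t) ^ 2 * (q - α₁) + (q + u₁ + u₂ + u₃ + t - u₃ - t) * (q + u₁ + u₂ + u₃ + t - u₂ - t) * (q + u₁ + u₂ + u₃ + t - t - u₁ - α₁ - β₃) - (q + u₁ + u₂ + u₃ + t) * ((q + u₁ + u₂ + u₃ + t - u₃ - t) * (q - α₁ + u₃ - β₃) + (q + u₁ + u₂ + u₃ + t - u₂ - t) * (q - α₁ + u₂) + (q + u₁ + u₂ + u₃ + t - t - u₁ - α₁ - β₃) * (q + u₁ + u₂ + u₃ + t - u₂ - u₃ - t)))) (hF0 : 0 ≤ F q u₁ u₂ u₃ t)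
    (hF1 : 0 ≤ F (q - α₁ - α₂) (u₁ + α₁) (u₂ + α₂) (u₃ - β₃) (t + β₃)) :
    0 ≤ threeB₁ q u₁ u₂ u₃ t α₁ α₂ 0 0 β₃ := by
  have key := slice_certificate₁ q u₁ u₂ u₃ t α₁ α₂ β₃
  have hM := slice_multiplier_sub q u₁ u₂ u₃ t α₁ α₂ β₃
  have hA : 0 ≤ 2 * t + α₁ + u₁ + u₃ + β₃ := by linarith
  have hB : 0 ≤ q + u₁ + 2 * u₂ + u₃ + 2 * t := by linarith
  have hA' : 0 ≤ 2 * t + u₁ + u₃ := by linarith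
  have hB' : 0 ≤ q + u₁ + 2 * u₂ + u₃ + 2 * t + α₂ + β₃ := by linarith
  have hL : 0 ≤ 2 * q + α₁ + α₂ + 4 * u₁ + 4 * u₂ + 4 * u₃ + 2 * β₃ + 8 * t := by linarith
  have hN : 0 ≤ 2 * q - α₁ + α₂ + 4 * u₂ := by linarith
  have hdiff : 0 ≤ (2 * t + α₁ + u₁ + u₃ + β₃) * (q + u₁ + 2 * u₂ + u₃ + 2 * t)
          - (2 * t + u₁ + u₃) * (q + u₁ + 2 * u₂ + u₃ + 2 * t + α₂ + β₃) := by
    have h1 : 0 ≤ (α₁ - α₂) * (2 * q + α₁ + α₂ + 4 * u₁ + 4 * u₂ + 4 * u₃ + 2 * β₃ + 8 * t) :=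
      mul_nonneg (by linarith) hL
    have h2 : 0 ≤ (α₁ + α₂ + 2 * β₃) * (2 * q - α₁ + α₂ + 4 * u₂) := mul_nonneg (by linarith) hN
    linarith
  have hrhs : 0 ≤ ((2 * t + α₁ + u₁ + u₃ + β₃) * (q + u₁ + 2 * u₂ + u₃ + 2 * t))
      * threeB₁ q u₁ u₂ u₃ t α₁ α₂ 0 0 β₃ := by
    rw [key]
    have t1 := mul_nonneg hdiff hE
    have t2 : 0 ≤ (2 * t + α₁ + u₁ + u₃ + β₃) * ((q + u₁ + 2 * u₂ + u₃ + 2 * t)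
        + (q + u₁ + 2 * u₂ + u₃ + 2 * t + α₂ + β₃)) * F q u₁ u₂ u₃ t :=
      mul_nonneg (mul_nonneg hA (by linarith)) hF0
    have t3 : 0 ≤ ((2 * t + u₁ + u₃) * (q + u₁ + 2 * u₂ + u₃ + 2 * t))
        * F (q - α₁ - α₂) (u₁ + α₁) (u₂ + α₂) (u₃ - β₃) (t + β₃) := mul_nonneg (mul_nonneg hA' hB) hF1
    linarith
  by_cases hpos : 0 < (2 * t + α₁ + u₁ + u₃ + β₃) * (q + u₁ + 2 * u₂ + u₃ + 2 * t)
  · exact nonneg_of_mul_nonneg_right hrhs hpos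
  · have hAB : (2 * t + α₁ + u₁ + u₃ + β₃) * (q + u₁ + 2 * u₂ + u₃ + 2 * t) = 0 :=
      le_antisymm (not_lt.mp hpos) (mul_nonneg hA hB)
    rcases mul_eq_zero.mp hAB with hA0 | hB0
    · -- A = 0: t = α₁ = u₁ = 0 and u₃ = β₃ = 0; then threeB₁ vanishes identically
      have ht0 : t = 0 := by linarith
      have ha0 : α₁ = 0 := by linarith
      have hu10 : u₁ = 0 := by linarith
      have hu30 : u₃ = 0 := by linarith
      have hb30 : β₃ = 0 := by linarith
      subst ht0 ha0 hu10 hu30 hb30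
      have : threeB₁ q (0:ℝ) u₂ 0 0 0 α₂ 0 0 0 = 0 := by simp only [threeB₁]; ring
      linarith
    · -- B = 0: everything vanishes
      have hq0 : q = 0 := by linarith
      have hu10 : u₁ = 0 := by linarith
      have hu20 : u₂ = 0 := by linarith
      have hu30 : u₃ = 0 := by linarith
      have ht0 : t = 0 := by linarith
      have ha10 : α₁ = 0 := by linarith
      have ha20 : α₂ = 0 := by linarith
      have hb30 : β₃ = 0 := by linarith
      subst hq0 hu10 hu20 hu30 ht0 ha10 ha20 hb30
      have : threeB₁ (0:ℝ) 0 0 0 0 0 0 0 0 0 = 0 := by simp only [threeB₁]; ring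
      linarith

/-- Region `α₁ ≤ α₂` by the `b ↔ c` mirror (uses the mirror hybrid row `E3(b≁c, a≁b, c≁{a,y})`). [folklore] -/
theorem threeB₁_nonneg_slice_of_ge {q u₁ u₂ u₃ t α₁ α₂ β₃ : ℝ}
    (hu₁ : 0 ≤ u₁) (hu₂ : 0 ≤ u₂) (ht : 0 ≤ t) (hα₁ : 0 ≤ α₁) (hα₂ : 0 ≤ α₂) (hβ₃ : 0 ≤ β₃)
    (hq : α₁ + α₂ ≤ q) (hu₃ : β₃ ≤ u₃) (hreg : α₁ ≤ α₂)
    (hE : 0 ≤ (2 * (q + u₂ + u₁ + u₃ + t) ^ 2 * (q - α₂) + (q + u₂ + u₁ + u₃ + t - u₃ - t) * (q + u₂ + u₁ + u₃ + t - u₁ - t) * (q + u₂ + u₁ + u₃ + t - t - u₂ - α₂ - β₃) - (q + u₂ + u₁ + u₃ + t) * ((q + u₂ + u₁ + u₃ + t - u₃ - t) * (q - α₂ + u₃ - β₃) + (q + u₂ + u₁ + u₃ + t - u₁ - t) * (q - α₂ + u₁) + (q + u₂ + u₁ + u₃ + t - t - u₂ - α₂ - β₃) * (q + u₂ + u₁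 + u₃ + t - u₁ - u₃ - t)))) (hF0 : 0 ≤ F q u₁ u₂ u₃ t)
    (hF1 : 0 ≤ F (q - α₁ - α₂) (u₁ + α₁) (u₂ + α₂) (u₃ - β₃) (t + β₃)) :
    0 ≤ threeB₁ q u₁ u₂ u₃ t α₁ α₂ 0 0 β₃ := by
  have hF0' : 0 ≤ F q u₂ u₁ u₃ t := by rw [F_swap]; exact hF0
  have hF1' : 0 ≤ F (q - α₂ - α₁) (u₂ + α₂) (u₁ + α₁) (u₃ - β₃) (t + β₃) := by
    rw [F_swap]; have : q - α₂ - α₁ = q - α₁ - α₂ := by ring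
    rw [this]; exact hF1
  have h := threeB₁_nonneg_slice_of_le hu₂ hu₁ ht hα₂ hα₁ hβ₃ (by linarith) hu₃ hreg hE hF0' hF1'
  rw [threeB₁_slice_swap] at h
  exact h

/-- `b ↔ c` symmetry of the second Bernstein piece on the slice. [folklore] -/
theorem threeB₂_slice_swap (q u₁ u₂ u₃ t α₁ α₂ β₃ : R) :
    threeB₂ q u₂ u₁ u₃ t α₂ α₁ 0 0 β₃ = threeB₂ q u₁ u₂ u₃ t α₁ α₂ 0 0 β₃ := by
  simp only [threeB₂]
  ring

set_option maxHeartbeats 800000 in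
/-- **Second Bernstein piece ≥ 0 on the slice, region `α₂ ≤ α₁`** (same hypotheses as `threeB₁_nonneg_slice_of_le`):
`(2A)(2B)·threeB₂ = ((2A)(2B) − (2A')(2B'))·hybE + (2A)(2B')·F(x⁰) + ((2A')(2B) + (2A)(2B))·F(x¹)`. [folklore] -/
theorem threeB₂_nonneg_slice_of_le {q u₁ u₂ u₃ t α₁ α₂ β₃ : ℝ}
    (hu₁ : 0 ≤ u₁) (hu₂ : 0 ≤ u₂) (ht : 0 ≤ t) (hα₁ : 0 ≤ α₁) (hα₂ : 0 ≤ α₂) (hβ₃ : 0 ≤ β₃)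
    (hq : α₁ + α₂ ≤ q) (hu₃ : β₃ ≤ u₃) (hreg : α₂ ≤ α₁)
    (hE : 0 ≤ (2 * (q + u₁ + u₂ + u₃ + t) ^ 2 * (q - α₁) + (q + u₁ + u₂ + u₃ + t - u₃ - t) * (q + u₁ + u₂ + u₃ + t - u₂ - t) * (q + u₁ + u₂ + u₃ + t - t - u₁ - α₁ - β₃) - (q + u₁ + u₂ + u₃ + t) * ((q + u₁ + u₂ + u₃ + t - u₃ - t) * (q - α₁ + u₃ - β₃) + (q + u₁ + u₂ + u₃ + t - u₂ - t) * (q - α₁ + u₂) + (q + u₁ + u₂ + u₃ + t - t - u₁ - α₁ - β₃) * (q + u₁ + u₂ + u₃ + t - u₂ - u₃ - t)))) (hF0 : 0 ≤ F q u₁ u₂ u₃ t)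
    (hF1 : 0 ≤ F (q - α₁ - α₂) (u₁ + α₁) (u₂ + α₂) (u₃ - β₃) (t + β₃)) :
    0 ≤ threeB₂ q u₁ u₂ u₃ t α₁ α₂ 0 0 β₃ := by
  have key := slice_certificate₁ q u₁ u₂ u₃ t α₁ α₂ β₃
  have hM := slice_multiplier_sub q u₁ u₂ u₃ t α₁ α₂ β₃
  have e2 := threeB₂_slice_eq q u₁ u₂ u₃ t α₁ α₂ β₃
  have hA : 0 ≤ 2 * t + α₁ + u₁ + u₃ + β₃ := by linarith
  have hB : 0 ≤ q + u₁ + 2 * u₂ + u₃ + 2 * t := by linarith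
  have hA' : 0 ≤ 2 * t + u₁ + u₃ := by linarith
  have hB' : 0 ≤ q + u₁ + 2 * u₂ + u₃ + 2 * t + α₂ + β₃ := by linarith
  have hdiff : 0 ≤ (2 * t + α₁ + u₁ + u₃ + β₃) * (q + u₁ + 2 * u₂ + u₃ + 2 * t)
        - (2 * t + u₁ + u₃) * (q + u₁ + 2 * u₂ + u₃ + 2 * t + α₂ + β₃) := by
    have h1 : 0 ≤ (α₁ - α₂) * (2 * q + α₁ + α₂ + 4 * u₁ + 4 * u₂ + 4 * u₃ + 2 * β₃ + 8 * t) :=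
      mul_nonneg (by linarith) (by linarith)
    have h2 : 0 ≤ (α₁ + α₂ + 2 * β₃) * (2 * q - α₁ + α₂ + 4 * u₂) := mul_nonneg (by linarith) (by linarith)
    linarith
  have key2 : ((2 * t + α₁ + u₁ + u₃ + β₃) * (q + u₁ + 2 * u₂ + u₃ + 2 * t)) * threeB₂ q u₁ u₂ u₃ t α₁ α₂ 0 0 β₃
      = ((2 * t + α₁ + u₁ + u₃ + β₃) * (q + u₁ + 2 * u₂ + u₃ + 2 * t)
            - (2 * t + u₁ + u₃) * (q + u₁ + 2 * u₂ + u₃ + 2 * t + α₂ + β₃)) * (2 * (q + u₁ + u₂ + u₃ + t) ^ 2 * (q - α₁) + (q + u₁ + u₂ + u₃ + t - u₃ - t) * (q + u₁ + u₂ + u₃ + t - u₂ - t) * (q + u₁ + u₂ + u₃ + t - t - u₁ - α₁ - β₃) - (q + u₁ + u₂ + u₃ + t) * ((q + u₁ + u₂ + u₃ + t - u₃ - t) * (q - α₁ + u₃ - β₃) + (q + u₁ + u₂ + u₃ + t - u₂ - t) * (q - α₁ + u₂) + (q + u₁ + u₂ + u₃ + t - t - u₁ - α₁ - β₃) * (q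 + u₁ + u₂ + u₃ + t - u₂ - u₃ - t)))
        + (2 * t + α₁ + u₁ + u₃ + β₃) * (q + u₁ + 2 * u₂ + u₃ + 2 * t + α₂ + β₃) * F q u₁ u₂ u₃ t
        + ((2 * t + u₁ + u₃) * (q + u₁ + 2 * u₂ + u₃ + 2 * t)
            + (2 * t + α₁ + u₁ + u₃ + β₃) * (q + u₁ + 2 * u₂ + u₃ + 2 * t))
            * F (q - α₁ - α₂) (u₁ + α₁) (u₂ + α₂) (u₃ - β₃) (t + β₃) := by
    rw [e2, mul_add, mul_sub, key]; ring
  have hrhs : 0 ≤ ((2 * t + α₁ + u₁ + u₃ + β₃) * (q + u₁ + 2 * u₂ + u₃ + 2 * t))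
      * threeB₂ q u₁ u₂ u₃ t α₁ α₂ 0 0 β₃ := by
    rw [key2]
    have t1 := mul_nonneg hdiff hE
    have t2 := mul_nonneg (mul_nonneg hA hB') hF0
    have t3 := mul_nonneg (add_nonneg (mul_nonneg hA' hB) (mul_nonneg hA hB)) hF1
    linarith
  by_cases hpos : 0 < (2 * t + α₁ + u₁ + u₃ + β₃) * (q + u₁ + 2 * u₂ + u₃ + 2 * t)
  · exact nonneg_of_mul_nonneg_right hrhs hpos
  · have hAB : (2 * t + α₁ + u₁ + u₃ + β₃) * (q + u₁ + 2 * u₂ + u₃ + 2 * t) = 0 :=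
      le_antisymm (not_lt.mp hpos) (mul_nonneg hA hB)
    rcases mul_eq_zero.mp hAB with hA0 | hB0
    · have ht0 : t = 0 := by linarith
      have ha0 : α₁ = 0 := by linarith
      have hu10 : u₁ = 0 := by linarith
      have hu30 : u₃ = 0 := by linarith
      have hb30 : β₃ = 0 := by linarith
      subst ht0 ha0 hu10 hu30 hb30
      have : threeB₂ q (0:ℝ) u₂ 0 0 0 α₂ 0 0 0 = 0 := by simp only [threeB₂]; ring
      linarith
    · have hq0 : q = 0 := by linarith
      have hu10 : u₁ = 0 := by linarith
      have hu20 : u₂ = 0 := by linarith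
      have hu30 : u₃ = 0 := by linarith
      have ht0 : t = 0 := by linarith
      have ha10 : α₁ = 0 := by linarith
      have ha20 : α₂ = 0 := by linarith
      have hb30 : β₃ = 0 := by linarith
      subst hq0 hu10 hu20 hu30 ht0 ha10 ha20 hb30
      have : threeB₂ (0:ℝ) 0 0 0 0 0 0 0 0 0 = 0 := by simp only [threeB₂]; ring
      linarith

/-- Region `α₁ ≤ α₂` for the second piece, by the `b ↔ c` mirror. [folklore] -/
theorem threeB₂_nonneg_slice_of_ge {q u₁ u₂ u₃ t α₁ α₂ β₃ : ℝ}
    (hu₁ : 0 ≤ u₁) (hu₂ : 0 ≤ u₂) (ht : 0 ≤ t) (hα₁ : 0 ≤ α₁) (hα₂ : 0 ≤ α₂) (hβ₃ : 0 ≤ β₃)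
    (hq : α₁ + α₂ ≤ q) (hu₃ : β₃ ≤ u₃) (hreg : α₁ ≤ α₂)
    (hE : 0 ≤ (2 * (q + u₂ + u₁ + u₃ + t) ^ 2 * (q - α₂) + (q + u₂ + u₁ + u₃ + t - u₃ - t) * (q + u₂ + u₁ + u₃ + t - u₁ - t) * (q + u₂ + u₁ + u₃ + t - t - u₂ - α₂ - β₃) - (q + u₂ + u₁ + u₃ + t) * ((q + u₂ + u₁ + u₃ + t - u₃ - t) * (q - α₂ + u₃ - β₃) + (q + u₂ + u₁ + u₃ + t - u₁ - t) * (q - α₂ + u₁) + (q + u₂ + u₁ + u₃ + t - t - u₂ - α₂ - β₃) * (q + u₂ + u₁ + u₃ + t - u₁ - u₃ - t)))) (hF0 : 0 ≤ F q u₁ u₂ u₃ t)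
    (hF1 : 0 ≤ F (q - α₁ - α₂) (u₁ + α₁) (u₂ + α₂) (u₃ - β₃) (t + β₃)) :
    0 ≤ threeB₂ q u₁ u₂ u₃ t α₁ α₂ 0 0 β₃ := by
  have hF0' : 0 ≤ F q u₂ u₁ u₃ t := by rw [F_swap]; exact hF0
  have hF1' : 0 ≤ F (q - α₂ - α₁) (u₂ + α₂) (u₁ + α₁) (u₃ - β₃) (t + β₃) := by
    rw [F_swap]; have : q - α₂ - α₁ = q - α₁ - α₂ := by ring
    rw [this]; exact hF1
  have h := threeB₂_nonneg_slice_of_le hu₂ hu₁ ht hα₂ hα₁ hβ₃ (by linarith) hu₃ hreg hE hF0' hF1'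
  rw [threeB₂_slice_swap] at h
  exact h

/-- **Both Bernstein pieces are nonnegative on the slice `β₁ = β₂ = 0`** given the two hybrid Richards–Sahi rows
`E3(b≁c,a≁c,b≁{a,y}) ≥ 0`, `E3(b≁c,a≁b,c≁{a,y}) ≥ 0` (here in transition variables) and SHK3⁺ at both endpoint laws —
hence, by `F_segment_nonneg_of_bernstein`, SHK3⁺ along the whole apex-edge segment for such laws. [folklore] -/
theorem bernstein_nonneg_slice {q u₁ u₂ u₃ t α₁ α₂ β₃ : ℝ}
    (hu₁ : 0 ≤ u₁) (hu₂ : 0 ≤ u₂) (ht : 0 ≤ t) (hα₁ : 0 ≤ α₁) (hα₂ : 0 ≤ α₂) (hβ₃ : 0 ≤ β₃)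
    (hq : α₁ + α₂ ≤ q) (hu₃ : β₃ ≤ u₃)
    (hE₁ : 0 ≤ (2 * (q + u₁ + u₂ + u₃ + t) ^ 2 * (q - α₁) + (q + u₁ + u₂ + u₃ + t - u₃ - t) * (q + u₁ + u₂ + u₃ + t - u₂ - t) * (q + u₁ + u₂ + u₃ + t - t - u₁ - α₁ - β₃) - (q + u₁ + u₂ + u₃ + t) * ((q + u₁ + u₂ + u₃ + t - u₃ - t) * (q - α₁ + u₃ - β₃) + (q + u₁ + u₂ + u₃ + t - u₂ - t) * (q - α₁ + u₂) + (q + u₁ + u₂ + u₃ + t - t - u₁ - α₁ - β₃) * (q + u₁ + u₂ + u₃ + t - u₂ - u₃ - t))))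
    (hE₂ : 0 ≤ (2 * (q + u₂ + u₁ + u₃ + t) ^ 2 * (q - α₂) + (q + u₂ + u₁ + u₃ + t - u₃ - t) * (q + u₂ + u₁ + u₃ + t - u₁ - t) * (q + u₂ + u₁ + u₃ + t - t - u₂ - α₂ - β₃) - (q + u₂ + u₁ + u₃ + t) * ((q + u₂ + u₁ + u₃ + t - u₃ - t) * (q - α₂ + u₃ - β₃) + (q + u₂ + u₁ + u₃ + t - u₁ - t) * (q - α₂ + u₁) + (q + u₂ + u₁ + u₃ + t - t - u₂ - α₂ - β₃) * (q + u₂ + u₁ + u₃ + t - u₁ - u₃ - t))))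
    (hF0 : 0 ≤ F q u₁ u₂ u₃ t) (hF1 : 0 ≤ F (q - α₁ - α₂) (u₁ + α₁) (u₂ + α₂) (u₃ - β₃) (t + β₃)) :
    0 ≤ threeB₁ q u₁ u₂ u₃ t α₁ α₂ 0 0 β₃ ∧ 0 ≤ threeB₂ q u₁ u₂ u₃ t α₁ α₂ 0 0 β₃ := by
  rcases le_total α₂ α₁ with h | h
  · exact ⟨threeB₁_nonneg_slice_of_le hu₁ hu₂ ht hα₁ hα₂ hβ₃ hq hu₃ h hE₁ hF0 hF1,
      threeB₂_nonneg_slice_of_le hu₁ hu₂ ht hα₁ hα₂ hβ₃ hq hu₃ h hE₁ hF0 hF1⟩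
  · exact ⟨threeB₁_nonneg_slice_of_ge hu₁ hu₂ ht hα₁ hα₂ hβ₃ hq hu₃ h hE₂ hF0 hF1,
      threeB₂_nonneg_slice_of_ge hu₁ hu₂ ht hα₁ hα₂ hβ₃ hq hu₃ h hE₂ hF0 hF1⟩

end Slice

end CubicThreePointStep

end Summit.CriticalPhenomena.PercolationContinuityZ3.Theorems
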